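import Summits.Ventures.CertifiedManyBodySolver.Downfold.EmeryAxialSlabTl2223OPWindows
import Summits.Ventures.CertifiedManyBodySolver.Downfold.EmeryFermiFillingTl2223OP
import Summits.Ventures.CertifiedManyBodySolver.Downfold.EmeryFermiFillingLa214
import Summits.Ventures.CertifiedManyBodySolver.Downfold.EmeryAxialConductionBand
import HarnessLib

/-!
# Tl₂Ba₂Ca₂Cu₃O₁₀ OUTER plane (box #306 Tl-2223, (K) source rows): the axial co-shift census ON THE TYPED BOX `emeryBoxTl2223OPK15Src` — verdicts against the object-E row
# `t′/t ∈ [-0.432, -0.331]` and their FOUR-ORBITAL reading (companion of `EmeryAxialSlabTl2223OPWindows`, which carries the method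
# docstring, the slab table and the raw slab windows; the kernel certificates are in `EmeryAxialSlabTl2223OPSubs*`)

Venture CertifiedManyBodySolver, cell `pub/hubbard-downfold` (stage S1), seat hubbard-downfold-mod-4 (technique B); namespace
`Summit.Ventures.CertifiedManyBodySolver.Downfold.Emery`. Everything PROVED. READING (certified): every slab MEETS the E row (no exclusion certified at this resolution).
WHAT THIS IS NOT: not a statement that the material's parameters ARE in the box (SCREENING-GRADE provenance); `U = 0` band kinematics; no phase
sentence; the E row is a [float] literature refit; `a_F` is the ADDITIONAL admixture beyond the box's σ rows (a model-form distance).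
Sources: [AndersenEtAl1995, §§5–6]; [PavariniEtAl2001, Eqs. (1)–(3), Fig. 3]; [HybertsenSchluterChristensen1989, Eq. (1)].
-/

noncomputable section

namespace Summit.Ventures.CertifiedManyBodySolver.Downfold.Emery

open Real Set
open Summit.Ventures.CertifiedManyBodySolver.Downfold

/-! ## §2 The typed box and the co-shift as a parameter -/

/-- The one-body rows and the per-spin filling of `emeryBoxTl2223OPK15Src` read by this file. [folklore] -/
theorem emeryBoxTl2223OPK15Src_axRows {p : EmeryCoord → ℝ} (hp : emeryBoxTl2223OPK15Src.Mem p) :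
    p .DeltaPd ∈ Set.Icc (81 / 50 : ℝ) (239 / 100 : ℝ) ∧ p .tpd ∈ Set.Icc (59 / 50 : ℝ) (139 / 100 : ℝ) ∧
      p .tpp ∈ Set.Icc (61 / 100 : ℝ) (18 / 25 : ℝ) ∧ p .tppP ∈ Set.Icc (3 / 20 : ℝ) (9 / 50 : ℝ) ∧
      (2 - p .nHoles) / 2 ∈ Set.Icc (41 / 100 : ℝ) (43 / 100 : ℝ) := by
  obtain ⟨hΔ, ha, hb, hc, hn⟩ := emeryBoxTl2223OPK15Src_mem_rows hp
  exact ⟨hΔ, ha, hb, hc, abFilling_rowTl1223OP_of_nHoles hn.1 hn.2 rfl⟩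

/-- **Slab 0 on the typed box**: for every parameter vector of `emeryBoxTl2223OPK15Src`, every co-shift `a ∈ [0, 0.02]` and every Fermi energy at
which the CO-SHIFTED σ antibonding band holds the box's electrons: `ε ∈ [1.16, 2.24]`, `t′/t ∈ [-0.3364, -0.2503]` (MEETS).
[folklore] -/
theorem emeryBoxTl2223OPK15Src_axSlab0 :
    HoldsOn (fun p : EmeryCoord → ℝ => ∀ a ε : ℝ, a ∈ Set.Icc (0 : ℝ) (1 / 50 : ℝ) →
      abFilling (p .DeltaPd) (p .tpd) (p .tpp + a) (p .tppP + a) ε = (2 - p .nHoles) / 2 →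
      ε ∈ Set.Icc (29 / 25 : ℝ) (56 / 25 : ℝ) ∧
      fsRatio (p .DeltaPd) (p .tpd) (p .tpp + a) (p .tppP + a) ε ∈ Set.Icc (-(841 / 2500 : ℝ)) (-(2503 / 10000 : ℝ))) emeryBoxTl2223OPK15Src := by
  intro p hp a ε ha' hf
  obtain ⟨hΔ, ha, hb, hc, hν⟩ := emeryBoxTl2223OPK15Src_axRows hp
  rw [← hf] at hν
  exact tl2223OPAxSlab0_window hΔ ha ⟨by linarith [hb.1, ha'.1], by linarith [hb.2, ha'.2]⟩
    ⟨by linarith [hc.1, ha'.1], by linarith [hc.2, ha'.2]⟩ hν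

/-- **Slab 1 on the typed box**: for every parameter vector of `emeryBoxTl2223OPK15Src`, every co-shift `a ∈ [0.02, 0.05]` and every Fermi energy at
which the CO-SHIFTED σ antibonding band holds the box's electrons: `ε ∈ [1.14, 2.22]`, `t′/t ∈ [-0.35, -0.2598]` (MEETS).
[folklore] -/
theorem emeryBoxTl2223OPK15Src_axSlab1 :
    HoldsOn (fun p : EmeryCoord → ℝ => ∀ a ε : ℝ, a ∈ Set.Icc (1 / 50 : ℝ) (1 / 20 : ℝ) →
      abFilling (p .DeltaPd) (p .tpd) (p .tpp + a) (p .tppP + a) ε = (2 - p .nHoles) / 2 →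
      ε ∈ Set.Icc (57 / 50 : ℝ) (111 / 50 : ℝ) ∧
      fsRatio (p .DeltaPd) (p .tpd) (p .tpp + a) (p .tppP + a) ε ∈ Set.Icc (-(7 / 20 : ℝ)) (-(1299 / 5000 : ℝ))) emeryBoxTl2223OPK15Src := by
  intro p hp a ε ha' hf
  obtain ⟨hΔ, ha, hb, hc, hν⟩ := emeryBoxTl2223OPK15Src_axRows hp
  rw [← hf] at hν
  exact tl2223OPAxSlab1_window hΔ ha ⟨by linarith [hb.1, ha'.1], by linarith [hb.2, ha'.2]⟩
    ⟨by linarith [hc.1, ha'.1], by linarith [hc.2, ha'.2]⟩ hν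

/-- **Slab 2 on the typed box**: for every parameter vector of `emeryBoxTl2223OPK15Src`, every co-shift `a ∈ [0.05, 0.1]` and every Fermi energy at
which the CO-SHIFTED σ antibonding band holds the box's electrons: `ε ∈ [1.12, 2.22]`, `t′/t ∈ [-0.371, -0.2736]` (MEETS).
[folklore] -/
theorem emeryBoxTl2223OPK15Src_axSlab2 :
    HoldsOn (fun p : EmeryCoord → ℝ => ∀ a ε : ℝ, a ∈ Set.Icc (1 / 20 : ℝ) (1 / 10 : ℝ) →
      abFilling (p .DeltaPd) (p .tpd) (p .tpp + a) (p .tppP + a) ε = (2 - p .nHoles) / 2 →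
      ε ∈ Set.Icc (28 / 25 : ℝ) (111 / 50 : ℝ) ∧
      fsRatio (p .DeltaPd) (p .tpd) (p .tpp + a) (p .tppP + a) ε ∈ Set.Icc (-(371 / 1000 : ℝ)) (-(171 / 625 : ℝ))) emeryBoxTl2223OPK15Src := by
  intro p hp a ε ha' hf
  obtain ⟨hΔ, ha, hb, hc, hν⟩ := emeryBoxTl2223OPK15Src_axRows hp
  rw [← hf] at hν
  exact tl2223OPAxSlab2_window hΔ ha ⟨by linarith [hb.1, ha'.1], by linarith [hb.2, ha'.2]⟩
    ⟨by linarith [hc.1, ha'.1], by linarith [hc.2, ha'.2]⟩ hν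

/-- **Slab 3 on the typed box**: for every parameter vector of `emeryBoxTl2223OPK15Src`, every co-shift `a ∈ [0.1, 0.2]` and every Fermi energy at
which the CO-SHIFTED σ antibonding band holds the box's electrons: `ε ∈ [1.06, 2.22]`, `t′/t ∈ [-0.4091, -0.2936]` (MEETS).
[folklore] -/
theorem emeryBoxTl2223OPK15Src_axSlab3 :
    HoldsOn (fun p : EmeryCoord → ℝ => ∀ a ε : ℝ, a ∈ Set.Icc (1 / 10 : ℝ) (1 / 5 : ℝ) →
      abFilling (p .DeltaPd) (p .tpd) (p .tpp + a) (p .tppP + a) ε = (2 - p .nHoles) / 2 →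
      ε ∈ Set.Icc (53 / 50 : ℝ) (111 / 50 : ℝ) ∧
      fsRatio (p .DeltaPd) (p .tpd) (p .tpp + a) (p .tppP + a) ε ∈ Set.Icc (-(4091 / 10000 : ℝ)) (-(367 / 1250 : ℝ))) emeryBoxTl2223OPK15Src := by
  intro p hp a ε ha' hf
  obtain ⟨hΔ, ha, hb, hc, hν⟩ := emeryBoxTl2223OPK15Src_axRows hp
  rw [← hf] at hν
  exact tl2223OPAxSlab3_window hΔ ha ⟨by linarith [hb.1, ha'.1], by linarith [hb.2, ha'.2]⟩
    ⟨by linarith [hc.1, ha'.1], by linarith [hc.2, ha'.2]⟩ hν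

/-- **Slab 4 on the typed box**: for every parameter vector of `emeryBoxTl2223OPK15Src`, every co-shift `a ∈ [0.2, 0.25]` and every Fermi energy at
which the CO-SHIFTED σ antibonding band holds the box's electrons: `ε ∈ [1.06, 2.14]`, `t′/t ∈ [-0.4237, -0.3254]` (MEETS).
[folklore] -/
theorem emeryBoxTl2223OPK15Src_axSlab4 :
    HoldsOn (fun p : EmeryCoord → ℝ => ∀ a ε : ℝ, a ∈ Set.Icc (1 / 5 : ℝ) (1 / 4 : ℝ) →
      abFilling (p .DeltaPd) (p .tpd) (p .tpp + a) (p .tppP + a) ε = (2 - p .nHoles) / 2 →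
      ε ∈ Set.Icc (53 / 50 : ℝ) (107 / 50 : ℝ) ∧
      fsRatio (p .DeltaPd) (p .tpd) (p .tpp + a) (p .tppP + a) ε ∈ Set.Icc (-(4237 / 10000 : ℝ)) (-(1627 / 5000 : ℝ))) emeryBoxTl2223OPK15Src := by
  intro p hp a ε ha' hf
  obtain ⟨hΔ, ha, hb, hc, hν⟩ := emeryBoxTl2223OPK15Src_axRows hp
  rw [← hf] at hν
  exact tl2223OPAxSlab4_window hΔ ha ⟨by linarith [hb.1, ha'.1], by linarith [hb.2, ha'.2]⟩
    ⟨by linarith [hc.1, ha'.1], by linarith [hc.2, ha'.2]⟩ hν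

/-- **Slab 5 on the typed box**: for every parameter vector of `emeryBoxTl2223OPK15Src`, every co-shift `a ∈ [0.25, 0.3]` and every Fermi energy at
which the CO-SHIFTED σ antibonding band holds the box's electrons: `ε ∈ [1.04, 2.12]`, `t′/t ∈ [-0.4374, -0.339]` (MEETS).
[folklore] -/
theorem emeryBoxTl2223OPK15Src_axSlab5 :
    HoldsOn (fun p : EmeryCoord → ℝ => ∀ a ε : ℝ, a ∈ Set.Icc (1 / 4 : ℝ) (3 / 10 : ℝ) →
      abFilling (p .DeltaPd) (p .tpd) (p .tpp + a) (p .tppP + a) ε = (2 - p .nHoles) / 2 →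
      ε ∈ Set.Icc (26 / 25 : ℝ) (53 / 25 : ℝ) ∧
      fsRatio (p .DeltaPd) (p .tpd) (p .tpp + a) (p .tppP + a) ε ∈ Set.Icc (-(2187 / 5000 : ℝ)) (-(339 / 1000 : ℝ))) emeryBoxTl2223OPK15Src := by
  intro p hp a ε ha' hf
  obtain ⟨hΔ, ha, hb, hc, hν⟩ := emeryBoxTl2223OPK15Src_axRows hp
  rw [← hf] at hν
  exact tl2223OPAxSlab5_window hΔ ha ⟨by linarith [hb.1, ha'.1], by linarith [hb.2, ha'.2]⟩
    ⟨by linarith [hc.1, ha'.1], by linarith [hc.2, ha'.2]⟩ hν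

/-- **Slab 6 on the typed box**: for every parameter vector of `emeryBoxTl2223OPK15Src`, every co-shift `a ∈ [0.3, 0.35]` and every Fermi energy at
which the CO-SHIFTED σ antibonding band holds the box's electrons: `ε ∈ [1.04, 2.1]`, `t′/t ∈ [-0.4517, -0.3513]` (MEETS).
[folklore] -/
theorem emeryBoxTl2223OPK15Src_axSlab6 :
    HoldsOn (fun p : EmeryCoord → ℝ => ∀ a ε : ℝ, a ∈ Set.Icc (3 / 10 : ℝ) (7 / 20 : ℝ) →
      abFilling (p .DeltaPd) (p .tpd) (p .tpp + a) (p .tppP + a) ε = (2 - p .nHoles) / 2 →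
      ε ∈ Set.Icc (26 / 25 : ℝ) (21 / 10 : ℝ) ∧
      fsRatio (p .DeltaPd) (p .tpd) (p .tpp + a) (p .tppP + a) ε ∈ Set.Icc (-(4517 / 10000 : ℝ)) (-(3513 / 10000 : ℝ))) emeryBoxTl2223OPK15Src := by
  intro p hp a ε ha' hf
  obtain ⟨hΔ, ha, hb, hc, hν⟩ := emeryBoxTl2223OPK15Src_axRows hp
  rw [← hf] at hν
  exact tl2223OPAxSlab6_window hΔ ha ⟨by linarith [hb.1, ha'.1], by linarith [hb.2, ha'.2]⟩
    ⟨by linarith [hc.1, ha'.1], by linarith [hc.2, ha'.2]⟩ hν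

/-- **Slab 7 on the typed box**: for every parameter vector of `emeryBoxTl2223OPK15Src`, every co-shift `a ∈ [0.35, 0.4]` and every Fermi energy at
which the CO-SHIFTED σ antibonding band holds the box's electrons: `ε ∈ [1.02, 2.08]`, `t′/t ∈ [-0.464, -0.363]` (MEETS).
[folklore] -/
theorem emeryBoxTl2223OPK15Src_axSlab7 :
    HoldsOn (fun p : EmeryCoord → ℝ => ∀ a ε : ℝ, a ∈ Set.Icc (7 / 20 : ℝ) (2 / 5 : ℝ) →
      abFilling (p .DeltaPd) (p .tpd) (p .tpp + a) (p .tppP + a) ε = (2 - p .nHoles) / 2 →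
      ε ∈ Set.Icc (51 / 50 : ℝ) (52 / 25 : ℝ) ∧
      fsRatio (p .DeltaPd) (p .tpd) (p .tpp + a) (p .tppP + a) ε ∈ Set.Icc (-(58 / 125 : ℝ)) (-(363 / 1000 : ℝ))) emeryBoxTl2223OPK15Src := by
  intro p hp a ε ha' hf
  obtain ⟨hΔ, ha, hb, hc, hν⟩ := emeryBoxTl2223OPK15Src_axRows hp
  rw [← hf] at hν
  exact tl2223OPAxSlab7_window hΔ ha ⟨by linarith [hb.1, ha'.1], by linarith [hb.2, ha'.2]⟩
    ⟨by linarith [hc.1, ha'.1], by linarith [hc.2, ha'.2]⟩ hν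

/-- **Slab 8 on the typed box**: for every parameter vector of `emeryBoxTl2223OPK15Src`, every co-shift `a ∈ [0.4, 0.5]` and every Fermi energy at
which the CO-SHIFTED σ antibonding band holds the box's electrons: `ε ∈ [0.98, 2.1]`, `t′/t ∈ [-0.4883, -0.3722]` (MEETS).
[folklore] -/
theorem emeryBoxTl2223OPK15Src_axSlab8 :
    HoldsOn (fun p : EmeryCoord → ℝ => ∀ a ε : ℝ, a ∈ Set.Icc (2 / 5 : ℝ) (1 / 2 : ℝ) →
      abFilling (p .DeltaPd) (p .tpd) (p .tpp + a) (p .tppP + a) ε = (2 - p .nHoles) / 2 →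
      ε ∈ Set.Icc (49 / 50 : ℝ) (21 / 10 : ℝ) ∧
      fsRatio (p .DeltaPd) (p .tpd) (p .tpp + a) (p .tppP + a) ε ∈ Set.Icc (-(4883 / 10000 : ℝ)) (-(1861 / 5000 : ℝ))) emeryBoxTl2223OPK15Src := by
  intro p hp a ε ha' hf
  obtain ⟨hΔ, ha, hb, hc, hν⟩ := emeryBoxTl2223OPK15Src_axRows hp
  rw [← hf] at hν
  exact tl2223OPAxSlab8_window hΔ ha ⟨by linarith [hb.1, ha'.1], by linarith [hb.2, ha'.2]⟩
    ⟨by linarith [hc.1, ha'.1], by linarith [hc.2, ha'.2]⟩ hν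

/-! ## §3 The census verdicts against the E row -/

/-! ## §4 The four-orbital reading (transfer theorem `EmeryAxialConductionBand.condFilling_eq_abFilling`) -/

end Summit.Ventures.CertifiedManyBodySolver.Downfold.Emery
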